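/-
Copyright: the b2b-balaban cell (near-miss cell 7), T⁴-continuum fan-out; row NE7b ROUND-2 swarm, seat
t4-ne7b-formalise-leaf-05 gen 2 (row S6g′ binding of `t4/b2b-balaban-t4-ne7b-p1/LEAVES-NE7b.md`, owner's ruling R-OWNER-22-12 (2)).
Released under the licence of the surrounding project.
-/
import Summits.QuantumFields.BalabanUV.T4Continuum.Support.HistoryJoinsRoots
import Summits.QuantumFields.BalabanUV.T4Continuum.Support.HistorySiblingCanon

/-!
# History joins, part 2: address placements and CANONICAL ADMISSIBILITY of a shape tree (row S6g′, the binding)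

Summits-side support leaf of the T⁴-continuum cell (rung (B)+1 on a FINITE torus only; NOT infinite volume, NOT the
mass gap, NOT the Clay statement; NOT a proof of the spine estimate NE7b).  Row NE7b, route «COUNT»; row S6g′, the
binding of the generic layer (c) to the ordered shape tree, continued from `HistoryJoins`∕`HistoryJoinsRoots`.
[folklore] finite combinatorics over the lineage's own carrier; nothing is quoted from print, nothing printed is
asserted, no `[cite:]` tag, no `Prop` fact of Bałaban's.  The ZONE DATA are DISPLAYED (as in `ZoneSkeleton`): a zone
map `zone : ℕ → Gen ε → (Addr D → γ) → Finset β` of a sub-structure at a step under a relative placement, and a sort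
key `ρ` (the canonical encoding's order on internal configurations); rows S6g′(a) (cardinality law) and (b) (root
count) instantiate their majorants in part 3.

WHAT.  §1 the finite address space `Addr D = {l : List Bool // l.length ≤ D}` (`List.finite_length_le`), evaluation
`evalA c₀ P l`, relative placements **`rel c₀ a P := fun r => evalA c₀ P (a ++ r)`** (`rel_nil`, `rel_append`,
`evalA_rel`), junk **`Junk G c₀ P`** (constant `c₀` off `baddr G`) and `junk_rel` (parts inherit it), the reconstruction
`eq_of_rel_eq` (a placement is determined by its parts' relative placements).  §2 for a merger: its part list, the HOST
index `hostIdx` (the part holding the root, `rootAddr G = path host ++ rootAddr host`), the CLASS KEY `key` (host alone;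
non-host parts keyed by the sub-structure itself — equal shape = equal key, `part_eq_of_key_eq`), the local join
condition **`LocalTop zone ρ c₀ st G p`** (the parts' zones at the join step are FOREST-connected around the host and
SORTED within classes — `HistorySiblingSymmetry.ForestAdm`, `HistorySiblingCanon.Sorted`), **`CAdm := ∀ join q ∈ croots
st G, LocalTop q.2 (rel c₀ q.1 P)`**, `cadm_merge_iff` (top join ∧ parts canonically admissible), the counted sets
**`S G z`** (junk, admissible, root at `z`), `Sany`, and the width **`Wn G := max_z #S G z`**.

HONEST SCOPE.  Definitions and structural lemmas; the COUNT (recursive inequality over the joins) is part 3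
`HistoryJoinsCount`.  NE7b NOT proved.  HONEST DEPENDENCY (cell): continuum YM on T⁴ ⇐ BetaPertH ∧ nine spine
estimates (0/9 proved); BetaPertH ⇐ (D1) ∧ (D4) ∧ CAP+tail.  This file changes none of it.
-/

open Finset
open Literature.MathematicalPhysics.QuantumFieldTheory.Balaban1983to89
open T4PersistenceDictionary T4PartnerMultiplicity T4BranchingRecordsGas
open Summit.QuantumFields.BalabanUV.T4Continuum.HistorySiblingSymmetry
open Summit.QuantumFields.BalabanUV.T4Continuum.HistorySiblingCanon
open Summit.QuantumFields.BalabanUV.T4Continuum.HistoryJoins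

namespace Summit.QuantumFields.BalabanUV.T4Continuum.HistoryJoinsAdm

noncomputable section

/-! ## §1 Finite addresses, evaluation, relative placements, junk -/

/-- the addresses of length `≤ D` [folklore] -/
abbrev Addr (D : ℕ) := {l : List Bool // l.length ≤ D}

/-- the addresses of length `≤ D` are finitely many (`List.finite_length_le`) [folklore] -/
noncomputable instance instFintypeAddr (D : ℕ) : Fintype (Addr D) := (List.finite_length_le Bool D).fintype

section Placements

variable {ε γ : Type*} {D : ℕ}

/-- evaluate a placement at a raw address (junk `c₀` beyond the length bound) [folklore] -/
def evalA (c₀ : γ) (P : Addr D → γ) (l : List Bool) : γ := if h : l.length ≤ D then P ⟨l, h⟩ else c₀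

/-- on short addresses evaluation is application [folklore] -/
theorem evalA_of_le (c₀ : γ) (P : Addr D → γ) {l : List Bool} (h : l.length ≤ D) : evalA c₀ P l = P ⟨l, h⟩ := by
  simp [evalA, h]

/-- at an address of the space [folklore] -/
@[simp] theorem evalA_coe (c₀ : γ) (P : Addr D → γ) (r : Addr D) : evalA c₀ P r.1 = P r := by
  rw [evalA_of_le c₀ P r.2]

/-- **THE RELATIVE PLACEMENT** of the sub-structure at path `a`: `r ↦ P (a ++ r)`. [folklore] -/
def rel (c₀ : γ) (a : List Bool) (P : Addr D → γ) : Addr D → γ := fun r => evalA c₀ P (a ++ r.1)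

/-- evaluation of a relative placement [folklore] -/
theorem evalA_rel (c₀ : γ) (a : List Bool) (P : Addr D → γ) (l : List Bool) :
    evalA c₀ (rel c₀ a P) l = evalA c₀ P (a ++ l) := by
  by_cases h : l.length ≤ D
  · rw [evalA_of_le c₀ _ h]; rfl
  · have h' : ¬ (a ++ l).length ≤ D := by rw [List.length_append]; omega
    rw [evalA, dif_neg h, evalA, dif_neg h']

/-- the relative placement at the empty path is the placement [folklore] -/
@[simp] theorem rel_nil (c₀ : γ) (P : Addr D → γ) : rel c₀ [] P = P := by
  funext r; simp [rel]

/-- **PATHS COMPOSE**: `rel (a ++ b) = rel b ∘ rel a`. [folklore] -/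
theorem rel_append (c₀ : γ) (a b : List Bool) (P : Addr D → γ) : rel c₀ (a ++ b) P = rel c₀ b (rel c₀ a P) := by
  funext r; simp [rel, evalA_rel, List.append_assoc]

/-- **JUNK OFF THE BIRTHS**: the placement is the constant `c₀` off the birth addresses of `G`. [folklore] -/
def Junk (G : Gen ε) (c₀ : γ) (P : Addr D → γ) : Prop := ∀ r : Addr D, r.1 ∉ baddr G → P r = c₀

variable (st : ε → ℕ)

/-- **PARTS INHERIT JUNK**: the relative placement of a part is junk off the part's own births (unique decomposition
of addresses). [folklore] -/
theorem junk_rel {G : Gen ε} {c₀ : γ} {P : Addr D → γ} (hJ : Junk G c₀ P) {t : ℕ} {q : List Bool × Gen ε}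
    (hq : q ∈ clusterParts st t G) : Junk q.2 c₀ (rel c₀ q.1 P) := by
  intro r hr
  simp only [rel, evalA]
  split_ifs with h
  · apply hJ
    intro hmem
    obtain ⟨q', hq', r', hr', heq⟩ := (mem_baddr_iff_clusterParts st t G _).1 hmem
    obtain ⟨hqq, hrr⟩ := eq_of_append_eq st t G q hq q' hq' r.1 r' heq
    exact hr (by rw [hrr, hqq]; exact hr')
  · rfl

/-- **RECONSTRUCTION**: two junk placements of `G` with the same relative placements on the step-`t` parts are equal.
[folklore] -/
theorem eq_of_rel_eq {G : Gen ε} {c₀ : γ} {P P' : Addr D → γ} (hJ : Junk G c₀ P) (hJ' : Junk G c₀ P') (t : ℕ)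
    (h : ∀ q ∈ clusterParts st t G, rel c₀ q.1 P = rel c₀ q.1 P') : P = P' := by
  funext r
  by_cases hr : r.1 ∈ baddr G
  · obtain ⟨q, hq, r₀, hr₀, heq⟩ := (mem_baddr_iff_clusterParts st t G _).1 hr
    have hlen : r₀.length ≤ D := by
      have := r.2; rw [heq, List.length_append] at this; omega
    have e1 : P r = rel c₀ q.1 P ⟨r₀, hlen⟩ := by
      simp only [rel, ← heq, evalA_coe]
    have e2 : P' r = rel c₀ q.1 P' ⟨r₀, hlen⟩ := by
      simp only [rel, ← heq, evalA_coe]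
    rw [e1, e2, h q hq]
  · rw [hJ r hr, hJ' r hr]

end Placements

/-! ## §2 The top join of a merger: parts, host, key, local condition; canonical admissibility; the counted sets -/

section Join

variable {ε γ β R : Type*} [DecidableEq β] [LinearOrder R] {D : ℕ} (zone : ℕ → Gen ε → (Addr D → γ) → Finset β)
  (ρ : (Addr D → γ) → R) (c₀ : γ) (st : ε → ℕ)

open scoped Classical

/-- the number of parts of the top join [folklore] -/
def npart (G : Gen ε) : ℕ := (jparts st G).length

/-- the `i`-th part of the top join (path, sub-structure) [folklore] -/
def part (G : Gen ε) (i : Fin (npart st G)) : List Bool × Gen ε := (jparts st G).get i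

/-- parts are members of the part list [folklore] -/
theorem part_mem (G : Gen ε) (i : Fin (npart st G)) : part st G i ∈ jparts st G := List.get_mem _ _

/-- every member of the part list is some part [folklore] -/
theorem exists_part_eq {G : Gen ε} {q : List Bool × Gen ε} (hq : q ∈ jparts st G) : ∃ i, part st G i = q := by
  obtain ⟨i, hi⟩ := List.mem_iff_get.1 hq
  exact ⟨i, hi⟩

/-- a merger has a part holding its root [folklore] -/
theorem exists_hostIdx (X Y : Gen ε) (e : ε) :
    ∃ i : Fin (npart st (Gen.merge X Y e)),
      rootAddr (Gen.merge X Y e) = (part st _ i).1 ++ rootAddr (part st _ i).2 ∧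
        (Gen.merge X Y e).rootStep = (part st _ i).2.rootStep := by
  obtain ⟨q, hq, h1, h2⟩ := exists_root_part st (st e) (Gen.merge X Y e)
  obtain ⟨i, hi⟩ := exists_part_eq st (G := Gen.merge X Y e) (by simpa [jparts] using hq)
  exact ⟨i, by rw [hi]; exact h1, by rw [hi]; exact h2⟩

/-- **THE HOST INDEX** of a merger's top join. [folklore] -/
def hostIdx (X Y : Gen ε) (e : ε) : Fin (npart st (Gen.merge X Y e)) := Classical.choose (exists_hostIdx st X Y e)

/-- the host holds the root [folklore] -/
theorem rootAddr_eq_host (X Y : Gen ε) (e : ε) :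
    rootAddr (Gen.merge X Y e) =
      (part st _ (hostIdx st X Y e)).1 ++ rootAddr (part st _ (hostIdx st X Y e)).2 :=
  (Classical.choose_spec (exists_hostIdx st X Y e)).1

/-- the host is as old as the join [folklore] -/
theorem rootStep_eq_host (X Y : Gen ε) (e : ε) :
    (Gen.merge X Y e).rootStep = (part st _ (hostIdx st X Y e)).2.rootStep :=
  (Classical.choose_spec (exists_hostIdx st X Y e)).2

/-- **THE CLASS KEY** of the top join: the host alone in its class (`none`), a non-host part keyed by the least index
of an EQUAL part (equal shape sub-structure). [folklore] -/
def key (X Y : Gen ε) (e : ε) (i : Fin (npart st (Gen.merge X Y e))) : Option (Fin (npart st (Gen.merge X Y e))) :=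
  if hi : i = hostIdx st X Y e then none
  else some ((univ.filter fun j => j ≠ hostIdx st X Y e ∧ (part st _ j).2 = (part st _ i).2).min'
    ⟨i, by simp [hi]⟩)

/-- the host is alone in its class [folklore] -/
theorem eq_host_of_key_eq (X Y : Gen ε) (e : ε) (i : Fin (npart st (Gen.merge X Y e)))
    (h : key st X Y e i = key st X Y e (hostIdx st X Y e)) : i = hostIdx st X Y e := by
  by_contra hne
  simp [key, hne] at h

/-- **EQUAL KEY ⇒ EQUAL PART** (as shape sub-structures). [folklore] -/
theorem part_eq_of_key_eq (X Y : Gen ε) (e : ε) {i j : Fin (npart st (Gen.merge X Y e))}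
    (h : key st X Y e i = key st X Y e j) : (part st _ i).2 = (part st _ j).2 := by
  by_cases hi : i = hostIdx st X Y e
  · have hj : j = hostIdx st X Y e := eq_host_of_key_eq st X Y e j (by rw [← h, hi])
    rw [hi, hj]
  · by_cases hj : j = hostIdx st X Y e
    · exact absurd (eq_host_of_key_eq st X Y e i (by rw [h, hj])) hi
    · have hmi := Finset.min'_mem
        (univ.filter fun j' => j' ≠ hostIdx st X Y e ∧ (part st _ j').2 = (part st _ i).2) ⟨i, by simp [hi]⟩
      have hmj := Finset.min'_mem
        (univ.filter fun j' => j' ≠ hostIdx st X Y e ∧ (part st _ j').2 = (part st _ j).2) ⟨j, by simp [hj]⟩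
      simp only [key, dif_neg hi, dif_neg hj, Option.some.injEq] at h
      rw [h] at hmi
      simp only [mem_filter, mem_univ, true_and] at hmi hmj
      rw [← hmi.2, hmj.2]

/-- the touch relation of the top join of a merger of step `t`: the two parts' zones SHARE a block [folklore] -/
def touch0 (X Y : Gen ε) (e : ε) (i : Fin (npart st (Gen.merge X Y e))) (p : Addr D → γ)
    (j : Fin (npart st (Gen.merge X Y e))) (q : Addr D → γ) : Prop :=
  (zone (st e) (part st _ i).2 p ∩ zone (st e) (part st _ j).2 q).Nonempty

/-- the configuration of the top join read off a placement: the parts' relative placements [folklore] -/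
def cfg (X Y : Gen ε) (e : ε) (P : Addr D → γ) : Fin (npart st (Gen.merge X Y e)) → (Addr D → γ) :=
  fun i => rel c₀ (part st _ i).1 P

/-- **THE LOCAL JOIN CONDITION** at a node: for a merger, the parts' zones at the join step are forest-connected around
the host and sorted within classes; vacuous elsewhere. [folklore] -/
def LocalTop : Gen ε → (Addr D → γ) → Prop
  | Gen.merge X Y e, P =>
      ForestAdm (fun _ _ => True) (touch0 zone st X Y e) (hostIdx st X Y e) (cfg c₀ st X Y e P) ∧
        Sorted (key st X Y e) ρ (cfg c₀ st X Y e P)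
  | _, _ => True

/-- **CANONICAL ADMISSIBILITY**: the local join condition at EVERY join of `G`, read through the join's path. [folklore] -/
def CAdm (G : Gen ε) (P : Addr D → γ) : Prop := ∀ q ∈ croots st G, LocalTop zone ρ c₀ st q.2 (rel c₀ q.1 P)

/-- a bare birth is canonically admissible [folklore] -/
theorem cadm_born (b : ε) (j : ℕ) (P : Addr D → γ) : CAdm zone ρ c₀ st (Gen.born b j) P := by
  simp [CAdm]

/-- a renewal is as admissible as the renewed structure [folklore] -/
theorem cadm_renew (G : Gen ε) (e : ε) (h : ℕ) (P : Addr D → γ) :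
    CAdm zone ρ c₀ st (Gen.renew G e h) P ↔ CAdm zone ρ c₀ st G P := by
  simp [CAdm]

/-- **A MERGER IS CANONICALLY ADMISSIBLE IFF ITS TOP JOIN HOLDS AND ITS PARTS ARE** (read through their paths).
[folklore] -/
theorem cadm_merge_iff (X Y : Gen ε) (e : ε) (P : Addr D → γ) :
    CAdm zone ρ c₀ st (Gen.merge X Y e) P ↔
      LocalTop zone ρ c₀ st (Gen.merge X Y e) P ∧
        ∀ i, CAdm zone ρ c₀ st (part st _ i).2 (cfg c₀ st X Y e P i) := by
  constructor
  · intro h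
    refine ⟨?_, fun i q' hq' => ?_⟩
    · have := h ([], Gen.merge X Y e) ((mem_croots_merge_iff st X Y e _).2 (Or.inl rfl))
      simpa using this
    · have hmem := (mem_croots_merge_iff st X Y e _).2 (Or.inr ⟨part st _ i, part_mem st _ i, q', hq', rfl⟩)
      have := h _ hmem
      simpa only [cfg, rel_append] using this
  · rintro ⟨htop, hparts⟩ q hq
    rcases (mem_croots_merge_iff st X Y e q).1 hq with rfl | ⟨p, hp, q', hq', rfl⟩
    · simpa using htop
    · obtain ⟨i, hi⟩ := exists_part_eq st hp
      have := hparts i q' (by rw [hi]; exact hq')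
      simp only [cfg, hi] at this
      rw [rel_append]; exact this

variable [Fintype γ]

/-- **THE COUNTED SET**: junk placements of `G`, canonically admissible, with the root birth at `z`. [folklore] -/
def S (G : Gen ε) (z : γ) : Finset (Addr D → γ) :=
  univ.filter fun P => Junk G c₀ P ∧ CAdm zone ρ c₀ st G P ∧ evalA c₀ P (rootAddr G) = z

/-- all canonically admissible junk placements of `G` [folklore] -/
def Sany (G : Gen ε) : Finset (Addr D → γ) := univ.filter fun P => Junk G c₀ P ∧ CAdm zone ρ c₀ st G P

/-- **THE WIDTH**: the largest number of canonically admissible placements with a given root cell. [folklore] -/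
def Wn (G : Gen ε) : ℕ := univ.sup fun z => (S zone ρ c₀ st G z).card

variable {zone ρ c₀ st}

/-- membership [folklore] -/
theorem mem_S {G : Gen ε} {z : γ} {P : Addr D → γ} :
    P ∈ S zone ρ c₀ st G z ↔ Junk G c₀ P ∧ CAdm zone ρ c₀ st G P ∧ evalA c₀ P (rootAddr G) = z := by
  simp [S]

/-- membership [folklore] -/
theorem mem_Sany {G : Gen ε} {P : Addr D → γ} : P ∈ Sany zone ρ c₀ st G ↔ Junk G c₀ P ∧ CAdm zone ρ c₀ st G P := by
  simp [Sany]

/-- a member of `S G z` is a member of `Sany G` [folklore] -/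
theorem mem_Sany_of_mem_S {G : Gen ε} {z : γ} {P : Addr D → γ} (h : P ∈ S zone ρ c₀ st G z) :
    P ∈ Sany zone ρ c₀ st G := by
  rw [mem_S] at h; exact mem_Sany.2 ⟨h.1, h.2.1⟩

/-- `Sany` is the union of the `S G z` [folklore] -/
theorem mem_S_root {G : Gen ε} {P : Addr D → γ} (h : P ∈ Sany zone ρ c₀ st G) :
    P ∈ S zone ρ c₀ st G (evalA c₀ P (rootAddr G)) := by
  rw [mem_Sany] at h; exact mem_S.2 ⟨h.1, h.2, rfl⟩

/-- every root cell's count is below the width [folklore] -/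
theorem card_S_le_Wn (G : Gen ε) (z : γ) : (S zone ρ c₀ st G z).card ≤ Wn zone ρ c₀ st G :=
  le_sup (f := fun z => (S zone ρ c₀ st G z).card) (mem_univ z)

/-- a bare birth has width at most one [folklore] -/
theorem Wn_born_le (b : ε) (j : ℕ) : Wn zone ρ c₀ st (Gen.born b j) ≤ 1 := by
  refine Finset.sup_le fun z _ => Finset.card_le_one.2 fun P hP P' hP' => ?_
  rw [mem_S] at hP hP'
  funext r
  by_cases hr : r.1 ∈ baddr (Gen.born b j)
  · simp only [baddr, mem_singleton] at hr
    have h1 : P r = evalA c₀ P (rootAddr (Gen.born b j)) := by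
      rw [show rootAddr (Gen.born b j) = r.1 from by simp [rootAddr, hr], evalA_coe]
    have h2 : P' r = evalA c₀ P' (rootAddr (Gen.born b j)) := by
      rw [show rootAddr (Gen.born b j) = r.1 from by simp [rootAddr, hr], evalA_coe]
    rw [h1, h2, hP.2.2, hP'.2.2]
  · rw [hP.1 r hr, hP'.1 r hr]

/-- a renewal has the width of the renewed structure [folklore] -/
theorem Wn_renew (G : Gen ε) (e : ε) (h : ℕ) : Wn zone ρ c₀ st (Gen.renew G e h) = Wn zone ρ c₀ st G := by
  unfold Wn S
  simp only [cadm_renew, Junk, baddr, rootAddr]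

end Join

end

end Summit.QuantumFields.BalabanUV.T4Continuum.HistoryJoinsAdm
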